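import Summits.QuantumFields.YangMills.Theorems.BalabanUVNodesN12AtRecord11CB10YZW

/-!
# BalabanUVNodes ∕ N12 AT THE STAGE-11 W-PINNED RECORD — WHAT N12 COSTS IN K1's ∃-CURRENCY TODAY (LOCATED): the four PRINTED displays of
# `Node00.WDisplays₁₀` ([Balaban1989LargeFieldI] Prop. 1 (1.78), (1.80), (1.89), (1.102)) are satisfiable by DEGENERATE residual letters at any step
# selector, so at a record of `Node00.IsRecordOfRecord₁₁CB10YZW` re-presenting a ₁₁C record `Dag.B15_main` holds at every run from EXACTLY the p.176
# (R-C2) term provisos on the record's OWN pre-𝐑 terms — and from nothing of [IV]'s printed estimates (sequel of `BalabanUVNodesN12AtRecord11CB10YZW`;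
# Track A, DAG node N12 = [B15, Balaban1989LargeFieldI] CMP 122 (1989) 175; cluster K1 `StabilityBAtRecordR11e`; seat `pub-ymgap-dag-n12-d` (R134 s2), 2026-08-26;
# count-neutral census, NOT a discharge)

HONEST FRAMING.  Count-neutral kernel BOOKKEEPING; nothing of Bałaban's asserted; N12 NOT discharged.  The route's K1 `StabilityBAtRecordR11e` (rev 6, 2026-08-26) is an
∃-form over def-T's `Node00.IsRecordOfRecord₁₁C F 2` (the prover CHOOSES the record); node00-def g30 ∕ g31 pinned the [IV] bundle `W` through OBJECTS for (0.2)–(0.6)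
(`WOfRecord₁₁ θ λ P` reads `Tstep rep_k` of the tower of record) but left the LETTERS `λ.LF ∕ λ.D189 ∕ λ.D1100` and the step `λ.kSel` RESIDUAL (`Node00.ResidW`, no law).
g30's `not_b15Leaf_WOfRecord₁₀_swapLF` reads that residuality in one direction (junk letters make the leaf FALSE ⇒ no ∀-form booking); THIS FILE reads it in the other:
* §1 `exists_residW_printedDisplays` — for EVERY Stage-9 parameter and EVERY step selector `k` there is a residual layer `λ` (`kSel := k`; the EMPTY Proposition-1 carrier
  `LF.Inst := PEmpty`; (1.89) letters with `χ_k(Ω_k^{∼4}) :≡ ⊥`, so `new189 ≡ ⊥`; the IDENTITY-INSERT 𝐑′-datum `ZK := TT := PUnit`, `ttOp :≡ 𝐓ρ_k`, so `rPrime1100 D = 𝐓ρ_k`)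
  at which Prop. 1 (1.78), (1.80), (1.89) and (1.102) HOLD at every run — vacuously ∕ by `rfl` up to `simp`; hence `exists_residW_wDisplays₁₀_of_termProvisos`: the term
  provisos ALONE (pre-𝐑 terms `rterm (reprTOfRecord₁₀ θ P (k P)) s` measurable ∕ ≥ 0 ∕ bounded ∕ of positive mass — p.176 ll.14–16, chair R446 (A) MASS reading) give a
  layer with `WDisplays₁₀ θ λ P` at every run.
  `exists_residW_wDisplays₁₀_of_provisos₁₀` — THREE of the four term provisos (measurable ∕ ≥ 0 ∕ bounded) ARE THE RECORD'S OWN at every step `k < K` (def-T's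
  `Provisos₁₀.rstep`, def-R's support-form (0.3) clause, junction `rfl` — the n12-e seat's `terms_of_provisos₁₀` is its public name), so per run POSITIVE MASS ALONE
  gives the displays below `K`.
* §2 `exists_world₁₁CB10YZW_b15_main_of_mass` — every admissible Stage-11 parameter with its provisos, any floor ∕ operator layer ∕ [B11] layer, any window, any step
  selector present a ₁₁CB10YZW record (datum `datumOfRecord₁₁ θ h`) at a world where `Dag.B15_main` holds at EVERY run, from positive mass at the selected step (+ the
  three provisos on the `K = 0` tori, where no step lies below `K`); `exists_rebind₁₁CB10YZW_b9_b15_main_of_isRecordOfRecord₁₁C_of_mass` — every ₁₁C record `(D, w)` is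
  RE-PRESENTED (SAME `D`, construction, window, block size) by a ₁₁CB10YZW world at which N06 (the N06 seat's zero operator layer) AND N12 hold at every run, given
  positive mass keyed to the presenting parameter.
WHAT THIS LOCATES (typing strength, count-neutral, NOT a second gap): in K1's ∃-currency the N12 conjunct of `DagBinding.Nodes` consumes NONE of [IV]'s printed estimates as
typed today — only POSITIVE MASS `0 < ∫ χ_{k+1}(s)·(𝐓e^A)_{k+1}(s)` of def-R's `χ` of record × def-T's `𝐓e^A` of record, every `s`, at ONE step below `K` per run
(the (R-C2) MASS reading; the record carries the support form); Proposition 1 (and the N12 s1 row's inhabitation of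
`B15.Prop1Printed` at a CONCRETE carrier), (1.80), (1.89), (1.102) constrain the construction only once `LF ∕ D189 ∕ D1100` are PINNED BY OBJECTS in the record (node00-def's
next [IV] pin: the minimisers of [B11] Thm 1 into `LF`, r11's `setting189Std` at the record's χ's into `D189`, def-R's ₇b (1.100) data into `D1100`) — the same located species
as `CarriersW`'s header («a pin of `LF` (and of `D189`, `D1100`) by objects must precede any ∀-form booking of N12»), now for the ∃-form.  Positive mass itself is NODE 00's
(positivity of `𝐓_k e^{A_k}`, non-nullity of the last-domain small-field constraint sets `χ_k(Ω_k)` — [Balaban1989LargeFieldII]'s business per n12-a's `B15LeafKnitMass`),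
neither proved nor assumed here.  One finite four-torus programme at fixed `ε`; nothing continuum ∕ ℝ⁴ ∕ OS ∕ mass gap ∕ Clay.  0 `sorry`, 0 `def`,
standard axioms.  Filed `--supports` K1 `StabilityBAtRecordR11e` (stmt-QuantumFields-19674).
Sources: [Balaban1989LargeFieldI] (0.2)–(0.6) p.176, Prop. 1 (1.78) p.194, (1.80) p.195, (1.89) p.198, (1.99)–(1.102) pp.200–201; [Balaban1988Convergent] (2.18) p.257,
(3.25) p.270; [Balaban1989LargeFieldII] Thm 1 + (0.1) pp.355–356.
-/

noncomputable section

open MeasureTheory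

namespace Summit.QuantumFields.YangMills.BalabanUVNodes.N12AtRecord11ExistsCurrency

open Literature.MathematicalPhysics.QuantumFieldTheory.Balaban1983to89
open Literature.MathematicalPhysics.QuantumFieldTheory.Balaban1983to89.T4Continuum (T4Family FiniteEpsData)
open Literature.MathematicalPhysics.QuantumFieldTheory.Balaban1983to89.DagBinding (WorldP leavesP PrintedCarriers15 B15Leaf B9LeafX B11Leaf)
open Literature.MathematicalPhysics.QuantumFieldTheory.Balaban1983to89.Node00
open B15Claim189Assembly (Setting189 new189 chiPP dom)
open B15Sect1Statements (RPrimeData Normalization1102 rPrime1100)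
open B15 (Prop1Printed Ineq180)
open B15.BasicStep (Claim189)
open B8Eq17ClassAkV1 (plaqsOf)
open YMDAG.UVSplit (RecordPred Datum AtRecord S_N12)
open Summit.QuantumFields.YangMills.BalabanUVNodes.N12AtRecord11CB10YZW (b15_main_of_up_view₁₁B10YZW_of_displays)
open Summit.QuantumFields.YangMills.BalabanUVNodes.N06AtRecord11CB10YZW (b9_main_of_up_view₁₁B10YZW)
open Summit.QuantumFields.YangMills.BalabanUVNodes.N06AtRecord9CB10Y (exists_junkOps_b9LeafX_Y9OfRecord)

variable {N : ℕ} [NeZero N]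

/-! ## §1 THE DEGENERATE LETTERS — the four printed displays hold at a junk residual layer, any step selector -/

section Letters

variable {F : T4Family}

/-- **THE FOUR PRINTED DISPLAYS OF `WDisplays₁₀` ARE SATISFIABLE BY DEGENERATE RESIDUAL LETTERS, at every Stage-9 parameter and every step selector `k`.**  The layer:
`kSel := k`; Proposition-1 carrier with NO instances (`Inst := PEmpty` — (1.78) quantifies over nothing; `B₅ := 1`); (1.89) letters on the coarsest lattice with one-point
carriers and `chiΩ4 :≡ ⊥`, so `new189 ≡ ⊥` and both the (1.80) display and `Claim189 (new189 ·) (chiPP ·)` are VACUOUS; the (1.100) datum of 𝐑′ with ONE large-field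
pattern, ONE 𝕋″-term acting as the constant `𝐓ρ_k` of record and NO inserts, so `rPrime1100 D = 𝐓ρ_k` and (1.102) is an identity.  Census (A2 ∕ R433 species,
kernel form): the typed conjuncts read residual carriers. [cite: Balaban1989LargeFieldI, Prop. 1 (1.78) p.194, (1.80) p.195, (1.89) p.198, (1.100)–(1.102) p.201 (bookkeeping: junk satisfiability of the typed statements at residual letters)] -/
theorem exists_residW_printedDisplays (θ : Stage9Params F N) (k : B12.RunParams → ℕ) :
    ∃ lam : ResidW F N, lam.kSel = k ∧ ∀ P : B12.RunParams,
      Prop1Printed (lam.LF P) ∧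
      (∀ U, new189 (lam.D189 P) U → ∀ i, (lam.D189 P).h ≤ i → i ≤ (lam.D189 P).k → ∀ q ∈ plaqsOf (dom (lam.D189 P) i),
        Ineq180 ((lam.D189 P).dev0 U q) ((lam.D189 P).ε (lam.D189 P).k) (lam.D189 P).η (lam.D189 P).B₃ (lam.D189 P).B₅ (lam.D189 P).M
          (lam.D189 P).δ ((lam.D189 P).dist q) (lam.D189 P).O1) ∧
      Claim189 (new189 (lam.D189 P)) (chiPP (lam.D189 P)) ∧
      Normalization1102 (lam.D1100 P) (trhoOfRecord9 F N θ.ν θ.τ9 (EOfRecord₁₀ F N θ) (wOfRecord₉ F N θ) θ.ppSel P (gOfRecord₁₀ F N θ P) (lam.kSel P)) := by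
  refine ⟨⟨k, fun _ => F.P 0, fun _ => PUnit, fun _ => PUnit,
      fun _ => ⟨PEmpty, fun i => i.elim, fun i => i.elim, fun i => i.elim, fun i => i.elim, fun i => i.elim, fun i => i.elim, fun i => i.elim,
        fun i => i.elim⟩,
      fun _ => ⟨fun _ => ∅, fun _ => ∅, ∅, 0, 0, 0, 0, 0, 0, 0, fun _ => 0, 0, 0, 0, 0, 0, 0, fun _ => 0, fun _ => False, fun _ => True, fun _ => True,
        fun _ => ∅, ∅, fun _ _ => 1, fun _ => PUnit.unit, ∅, fun _ _ => 1, fun _ => 1, fun _ _ => 0, fun _ _ => 0, fun _ _ => 0⟩,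
      fun P =>
        { ZK := PUnit, TT := fun _ => PUnit,
          ttOp := fun _ _ _ => trhoOfRecord9 F N θ.ν θ.τ9 (EOfRecord₁₀ F N θ) (wOfRecord₉ F N θ) θ.ppSel P (gOfRecord₁₀ F N θ P) (k P),
          Fam := fun _ => PEmpty, fam := fun _ e => e.elim, expA := fun _ _ => 0 }⟩, rfl, fun P => ⟨?_, ?_, ?_, ?_⟩⟩
  · exact ⟨1, one_pos, fun i => i.elim⟩
  · rintro U ⟨h4, -⟩
    exact h4.elim
  · rintro U ⟨h4, -⟩
    exact h4.elim
  · unfold Normalization1102 rPrime1100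
    simp

/-- **HENCE THE TERM PROVISOS ALONE GIVE THE DISPLAYS**: if at every run the pre-𝐑 terms `t_s = χ_{k+1}(s)·(𝐓e^A)_{k+1}(s)` of `Tstep rep_k` of the tower of record
(`reprTOfRecord₁₀ θ P (k P)`) are measurable, nonnegative, uniformly bounded and of positive mass (p.176 ll.14–16 in the (R-C2) MASS reading), then SOME residual layer with
step selector `k` satisfies `WDisplays₁₀ θ λ P` at every run — the four printed statements contributed by the degenerate letters of `exists_residW_printedDisplays`.
[cite: Balaban1989LargeFieldI, (0.2)–(0.6) p.176, Prop. 1 (1.78) p.194, (1.80) p.195, (1.89) p.198, (1.102) p.201 (bookkeeping)] -/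
theorem exists_residW_wDisplays₁₀_of_termProvisos (θ : Stage9Params F N) (k : B12.RunParams → ℕ)
    (hm : ∀ (P : B12.RunParams) s, Measurable (rterm (reprTOfRecord₁₀ F N θ P (k P)) s))
    (h0 : ∀ (P : B12.RunParams) s V, 0 ≤ rterm (reprTOfRecord₁₀ F N θ P (k P)) s V)
    (hC : ∀ P : B12.RunParams, ∃ Cρ : ℝ, ∀ s V, rterm (reprTOfRecord₁₀ F N θ P (k P)) s V ≤ Cρ)
    (hmass : ∀ (P : B12.RunParams) s, 0 < ∫ V, rterm (reprTOfRecord₁₀ F N θ P (k P)) s V ∂(fieldMeasure (F.P P.K) (k P + 1) (SU N))) :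
    ∃ lam : ResidW F N, lam.kSel = k ∧ ∀ P : B12.RunParams, WDisplays₁₀ θ lam P := by
  obtain ⟨lam, hk, hd⟩ := exists_residW_printedDisplays θ k
  subst hk
  exact ⟨lam, rfl, fun P => ⟨hm P, h0 P, hC P, hmass P, (hd P).1, (hd P).2.1, (hd P).2.2.1, (hd P).2.2.2⟩⟩

/-- **SO, PER RUN, WHAT THE DISPLAYS COST**: for every Stage-9 parameter WITH ITS STAGE-10 PROVISOS and every step selector `k` there is ONE residual layer (the degenerate
letters of `exists_residW_printedDisplays`) such that at every run `P`: the four term provisos at step `k P` give `WDisplays₁₀ θ λ P`; and on runs with `k P < P.K`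
(every run of Bałaban's, `K ≥ 1`, at a step below `K`) POSITIVE MASS ALONE gives it — THREE of the four term provisos (measurable ∕ ≥ 0 ∕ bounded pre-𝐑 terms) ARE THE
RECORD'S OWN there: def-T's `Provisos₁₀.rstep P k hk` (def-R's support-form (0.3) clause), whose `toRepData.piece s` IS `rterm (Tstep rep_k) s` (`rfl`; the public
reading of this junction is the n12-e seat's `B15RPrime1100AtRecord.terms_of_provisos₁₀`, consumed here only through def-T's field).  What the record does NOT carry is
the fourth, POSITIVE MASS (the (R-C2) MASS reading). [cite: Balaban1989LargeFieldI, (0.2)–(0.6) p.176, Prop. 1 p.194, (1.80) p.195, (1.89) p.198, (1.102) p.201 (bookkeeping)] -/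
theorem exists_residW_wDisplays₁₀_of_provisos₁₀ (θ : Stage9Params F N) (h : θ.Provisos₁₀) (k : B12.RunParams → ℕ) :
    ∃ lam : ResidW F N, lam.kSel = k ∧ ∀ P : B12.RunParams,
      ((∀ s, Measurable (rterm (reprTOfRecord₁₀ F N θ P (k P)) s)) → (∀ s V, 0 ≤ rterm (reprTOfRecord₁₀ F N θ P (k P)) s V) →
        (∃ Cρ : ℝ, ∀ s V, rterm (reprTOfRecord₁₀ F N θ P (k P)) s V ≤ Cρ) →
        (∀ s, 0 < ∫ V, rterm (reprTOfRecord₁₀ F N θ P (k P)) s V ∂(fieldMeasure (F.P P.K) (k P + 1) (SU N))) → WDisplays₁₀ θ lam P) ∧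
      (k P < P.K → (∀ s, 0 < ∫ V, rterm (reprTOfRecord₁₀ F N θ P (k P)) s V ∂(fieldMeasure (F.P P.K) (k P + 1) (SU N))) →
        WDisplays₁₀ θ lam P) := by
  obtain ⟨lam, hk, hd⟩ := exists_residW_printedDisplays θ k
  subst hk
  refine ⟨lam, rfl, fun P => ⟨fun hm h0 hC hmass => ⟨hm, h0, hC, hmass, (hd P).1, (hd P).2.1, (hd P).2.2.1, (hd P).2.2.2⟩, fun hK hmass => ?_⟩⟩
  obtain ⟨hm, h0, hC, -⟩ := h.rstep P (lam.kSel P) hK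
  exact ⟨hm, h0, hC, hmass, (hd P).1, (hd P).2.1, (hd P).2.2.1, (hd P).2.2.2⟩

end Letters

/-! ## §2 WHAT N12 COSTS IN K1's ∃-CURRENCY: a ₁₁CB10YZW record with `Dag.B15_main` at every run from POSITIVE MASS at one step below `K` -/

section Currency

variable {F : T4Family}

/-- **A STAGE-11 RECORD WITH N12 AT EVERY RUN, FROM POSITIVE MASS ALONE (below `K`).**  Every admissible Stage-11 parameter with its provisos, ANY floor ∕ operator
layer ∕ [B11] layer, any window `0 < γw ≤ θ.γ` and any step selector `k` present a record of `IsRecordOfRecord₁₁CB10YZW` (datum `datumOfRecord₁₁ θ h`) at a world where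
`Dag.B15_main` HOLDS AT EVERY RUN, provided: (`hmass`) at every run every pre-𝐑 term of `Tstep rep_{k P}` of the tower of record has POSITIVE MASS, and (`hdeg`) on the
runs where the selected step is NOT below `K` (with n12-a's default `k P := P.K − 1`: exactly the `K = 0` tori, outside [I]'s `K ≥ 1`) the three remaining term provisos
are supplied — below `K` they are the record's own (def-T's `Provisos₁₀.rstep`).  The [IV] layer is the degenerate one of §1; NOTHING of [IV]'s Prop. 1 ∕ (1.80) ∕
(1.89) ∕ (1.102) is consumed (`N12AtRecord11CB10YZW.b15_main_of_up_view₁₁B10YZW_of_displays` BY NAME).  LOCATED; NOT a discharge.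
[cite: Balaban1989LargeFieldI, (0.2)–(0.6) p.176, Prop. 1 p.194; Balaban1989LargeFieldII, Thm 1 + (0.1) pp.355–356 (bookkeeping: the ∃-currency at residual letters)] -/
theorem exists_world₁₁CB10YZW_b15_main_of_mass (θ : Stage11Params F N) (h : θ.Provisos₁₁) (hθ : θ.Admissible) (Mstar : ℕ)
    (ops : OpsY N θ.toStage3Params Mstar) (ζ : ResidZ F N) {γw : ℝ} (hγw : 0 < γw ∧ γw ≤ θ.γ) (k : B12.RunParams → ℕ)
    (hmass : ∀ (P : B12.RunParams) s,
      0 < ∫ V, rterm (reprTOfRecord₁₀ F N θ.toStage9Params P (k P)) s V ∂(fieldMeasure (F.P P.K) (k P + 1) (SU N)))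
    (hdeg : ∀ P : B12.RunParams, P.K ≤ k P →
      (∀ s, Measurable (rterm (reprTOfRecord₁₀ F N θ.toStage9Params P (k P)) s)) ∧
      (∀ s V, 0 ≤ rterm (reprTOfRecord₁₀ F N θ.toStage9Params P (k P)) s V) ∧
      ∃ Cρ : ℝ, ∀ s V, rterm (reprTOfRecord₁₀ F N θ.toStage9Params P (k P)) s V ≤ Cρ) :
    ∃ (lamW : ResidW F N) (w : WorldP), lamW.kSel = k ∧ IsRecordOfRecord₁₁CB10YZW F N (datumOfRecord₁₁ F N θ h) w ∧ w.γ = γw ∧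
      (∀ P, w.up P = upOfRecord₅C F N (θ.view₁₁B10YZW F N Mstar ops ζ lamW) P) ∧ ∀ P : B12.RunParams, Dag.B15_main (leavesP w P) := by
  obtain ⟨lamW, hk, hd⟩ := exists_residW_wDisplays₁₀_of_provisos₁₀ θ.toStage9Params h.base k
  obtain ⟨w₀⟩ := nonempty_worldP
  refine ⟨lamW, { w₀ with
      C := (datumOfRecord₁₁ F N θ h).C, γ := γw, L := (θ.L : ℝ), one_lt_L := by exact_mod_cast θ.hL.2,
      up := fun P => upOfRecord₅C F N (θ.view₁₁B10YZW F N Mstar ops ζ lamW) P }, hk,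
    ⟨θ, h, Mstar, ops, ζ, lamW, hθ, rfl, rfl, hγw, rfl, fun _ => rfl⟩, rfl, fun _ => rfl, fun P => ?_⟩
  refine b15_main_of_up_view₁₁B10YZW_of_displays θ Mstar ops ζ lamW rfl ?_
  rcases lt_or_ge (k P) P.K with hK | hK
  · exact (hd P).2 hK (hmass P)
  · obtain ⟨hm, h0, hC⟩ := hdeg P hK
    exact (hd P).1 hm h0 hC (hmass P)

variable {D : Datum F N} {w : WorldP}

/-- **EVERY ₁₁C RECORD IS RE-PRESENTED BY A ₁₁CB10YZW WORLD WITH N06 AND N12 AT EVERY RUN, given positive mass keyed to the presenting parameter** — SAME datum `D`,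
same construction, window and block size; floor `0`, the N06 seat's ZERO operator layer (`N06AtRecord9CB10Y.exists_junkOps_b9LeafX_Y9OfRecord`, whence `Dag.B9_main` by
`N06AtRecord11CB10YZW.b9_main_of_up_view₁₁B10YZW`), any [B11] layer, the degenerate [IV] layer of §1.  So in the V1 ∃-form of K1 `StabilityBAtRecordR11e` the N06 ∧ N12
conjuncts of `DagBinding.Nodes` cost EXACTLY `hmass` (+ `hdeg` on the `K = 0` tori): for every `(θ, h)` presenting `(D, w)` as a ₁₁C record, positive mass of the
pre-𝐑 terms of `Tstep rep_{k P}` — NODE 00's business (positivity of `𝐓_k e^{A_k}`, non-nullity of the last-domain constraint sets `χ_k(Ω_k)`); LOCATED, count-neutral;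
NOT-A-DISCHARGE of N06 or N12. [cite: Balaban1989LargeFieldI, (0.2)–(0.6) p.176, Prop. 1 p.194; Balaban1985BackgroundPropagators, Thms 3.1–3.15 pp.397–432; Balaban1989LargeFieldII, Thm 1 + (0.1) pp.355–356 (bookkeeping)] -/
theorem exists_rebind₁₁CB10YZW_b9_b15_main_of_isRecordOfRecord₁₁C_of_mass (hrec : IsRecordOfRecord₁₁C F N D w) (k : B12.RunParams → ℕ)
    (hmass : ∀ (θ : Stage11Params F N) (hP : θ.Provisos₁₁), θ.Admissible → D = datumOfRecord₁₁ F N θ hP →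
      (∀ P, w.up P = upOfRecord₅C F N (θ.toStage5₁₁ F N) P) →
        (∀ (P : B12.RunParams) s,
          0 < ∫ V, rterm (reprTOfRecord₁₀ F N θ.toStage9Params P (k P)) s V ∂(fieldMeasure (F.P P.K) (k P + 1) (SU N))) ∧
        (∀ P : B12.RunParams, P.K ≤ k P →
          (∀ s, Measurable (rterm (reprTOfRecord₁₀ F N θ.toStage9Params P (k P)) s)) ∧
          (∀ s V, 0 ≤ rterm (reprTOfRecord₁₀ F N θ.toStage9Params P (k P)) s V) ∧
          ∃ Cρ : ℝ, ∀ s V, rterm (reprTOfRecord₁₀ F N θ.toStage9Params P (k P)) s V ≤ Cρ)) :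
    ∃ w' : WorldP, IsRecordOfRecord₁₁CB10YZW F N D w' ∧ w'.C = w.C ∧ w'.γ = w.γ ∧ w'.L = w.L ∧
      ∀ P : B12.RunParams, Dag.B9_main (leavesP w' P) ∧ Dag.B15_main (leavesP w' P) := by
  obtain ⟨θ, hP, hθ, hD, hCw, hγ, hL, hup⟩ := hrec
  obtain ⟨hm', hdeg⟩ := hmass θ hP hθ hD hup
  obtain ⟨lamW, -, hd⟩ := exists_residW_wDisplays₁₀_of_provisos₁₀ θ.toStage9Params hP.base k
  obtain ⟨ops, -, hleaf⟩ := exists_junkOps_b9LeafX_Y9OfRecord (N := N) θ.toStage3Params hθ.1.1.1.1.1 0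
  obtain ⟨ζ⟩ := nonempty_residZ F N
  refine ⟨{ w with up := fun P => upOfRecord₅C F N (θ.view₁₁B10YZW F N 0 ops ζ lamW) P },
    ⟨θ, hP, 0, ops, ζ, lamW, hθ, hD, hCw, hγ, hL, fun _ => rfl⟩, rfl, rfl, rfl, fun P => ⟨?_, ?_⟩⟩
  · exact b9_main_of_up_view₁₁B10YZW θ 0 ops ζ lamW _ (fun _ => rfl) hleaf P
  · refine b15_main_of_up_view₁₁B10YZW_of_displays θ 0 ops ζ lamW rfl ?_
    rcases lt_or_ge (k P) P.K with hK | hK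
    · exact (hd P).2 hK (hm' P)
    · obtain ⟨hm, h0, hC⟩ := hdeg P hK
      exact (hd P).1 hm h0 hC (hm' P)

end Currency

end Summit.QuantumFields.YangMills.BalabanUVNodes.N12AtRecord11ExistsCurrency

end
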